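import Summits.NavierStokesRegularity.NavierStokesRegularity.Theorems.BoundedTemperatureClosed.Negative.CollinearBites

/-!
# Crux `BoundedTemperatureClosed` (stmt-NavierStokesRegularity-18303) — strategist checks:
# the exact two-leaf decomposition (D2 of STRATEGY-CENSUS.md) and the joint-closedness strengthening (S1)

Kernel-checked companion of the crux-strategist's STRATEGY-CENSUS (wall-breaker seat, 2026-08-17). All
sorry-free. The crux as filed, `∀ 𝒜 sym canc, ∀ M, IsClosed S_{𝒜,M}`, is EQUIVALENT to the conjunction of
two leaves (`boundedTemperatureClosed_iff_subs`):

* `NSTypeICeilingClosed` — a pure Navier–Stokes statement: the set of Type-I ceilings of Schwartz-data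
  `H¹⁰_df`-mild Navier–Stokes blow-ups is closed from below ("a positive ceiling all of whose strict upper
  ceilings are admissible is admissible"); it is literally `¬ TypeIInfimumNotAttainedNS`
  (`nsTypeICeilingClosed_iff_not_typeIInfimumNotAttainedNS`), the registered open statement `H` of the
  negative lane — so this leaf is the quarantined NS Type-I dichotomy, not a lemma;
* `OffCollinearClosed` — the crux restricted to averaging data whose form is NOT a real multiple of the
  Euler form on `H¹⁰_df` (every segment point `θ < 1` then carries a genuine averaged component).

The glue `boundedTemperatureClosed_of_subs` is a case split on collinearity; on the collinear sector
`B̃ = κ·B` the set is computed EXACTLY for every real `κ` and every sign of the coefficient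
`c(θ) = (1-θ)κ + θ` (`mem_btSet_iff_of_form_eq_smul_of_ne_zero`: membership `↔ nsTypeI[|c(θ)|·M]`, by the
amplitude scaling `u ↦ c(θ)u` with `c(θ)` of either sign, `typeIBlowup_smul_abs`;
`not_mem_btSet_of_form_eq_smul_of_eq_zero`: the heat point `c(θ) = 0` is never a member), so
`S_{𝒜,M} = [0,1] ∩ (θ ↦ |c(θ)|M)⁻¹(𝒯)` with `𝒯` the ceiling set, which is closed under
`NSTypeICeilingClosed` plus Leray's floor (`isClosed_ceilingSet`). The strengthening `JointClosed`
(closedness jointly in `(θ, M)`) implies the crux by slicing (`boundedTemperatureClosed_of_jointClosed`)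
and therefore inherits the same NS leaf.

Why the split is typed but NOT filed as a route edit: see STRATEGY-CENSUS.md §5 (neither leaf gains a plan;
`closes` consumes the parent).

## References

* T. Tao, J. Amer. Math. Soc. 29 (2016), arXiv:1402.0290v3, §1.1 (1.13), (1.15), §3.1–§3.2. [`Tao2016AveragedNS`]
* W. Rusin, V. Šverák, J. Funct. Anal. 260 (2011), arXiv:0911.0500, §1 question (Q). [`RusinSverak2011`]
* H. Koch, N. Nadirashvili, G. Seregin, V. Šverák, Acta Math. 203 (2009), §1. [`KochNadirashviliSereginSverak2009`]
-/

noncomputable section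

-- the nested summit namespace `…NavierStokesRegularity.NavierStokesRegularity…` is the tree's layout (D-0017)
set_option linter.dupNamespace false

namespace Summit.NavierStokesRegularity.NavierStokesRegularity.Theorems.PumpContinuationBoundedTemperatureClosedSplit

open MeasureTheory Set Filter Topology
open scoped ENNReal
open Literature.Analysis.FluidPDE Literature.Analysis.FluidPDE.Tao2016
open Summit.NavierStokesRegularity.NavierStokesRegularity.Theses.PumpContinuation
open Summit.NavierStokesRegularity.NavierStokesRegularity.Theorems.BoundedTemperatureClosed.Negative
open Summit.NavierStokesRegularity.NavierStokesRegularity.Theorems.PumpContinuationEulerProximatePump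
  (isMildSolutionFor_smul smul_inv_of_smul inv_smul_smul_ofReal)
open Summit.NavierStokesRegularity.NavierStokesRegularity.Theorems.PerpetualPumpEulerTypeIGlue
  (eLpNorm_coe_const_smul isDivFree_const_smul)
open Summit.NavierStokesRegularity.NavierStokesRegularity.Theorems.PumpContinuationSegmentAveraged
  (isMildSolutionFor_Ico_congr_memH10df)

/-- The bounded-temperature blow-up set of the datum `𝒜` at ceiling `M` along the segment
`T_θ = (1-θ)·B̃_𝒜 + θ·B` — verbatim the set whose closedness the crux asserts. -/
local notation3 "btSet[" 𝒜 ", " M "]" =>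
  {θ : ℝ | θ ∈ Set.Icc (0 : ℝ) 1 ∧
    ∃ u₀ : SchwartzMap (EuclideanSpace ℝ (Fin 3)) (EuclideanSpace ℝ (Fin 3)),
      Literature.Analysis.FluidPDE.VectorCalculus.IsDivFree ⇑u₀ ∧ ∃ S : ℝ, 0 < S ∧
      ∃ u : ℝ → Literature.Analysis.FluidPDE.Tao2016.L2C,
        Literature.Analysis.FluidPDE.Tao2016.IsMildSolutionFor
          (fun a b c => ((1 - θ : ℝ) : ℂ) * AveragingDatum.form 𝒜 a b c +
            ((θ : ℝ) : ℂ) * Literature.Analysis.FluidPDE.Tao2016.eulerForm a b c)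
          (Literature.Analysis.FluidPDE.Tao2016.schwartzL2 u₀) (Set.Ico 0 S) u ∧
        (∀ t ∈ Set.Ico 0 S, MeasureTheory.eLpNorm (u t) ⊤ MeasureTheory.volume ≤
          ENNReal.ofReal (M / Real.sqrt (S - t))) ∧
        ¬ ∃ S' : ℝ, S < S' ∧ ∃ v : ℝ → Literature.Analysis.FluidPDE.Tao2016.L2C,
          Literature.Analysis.FluidPDE.Tao2016.IsMildSolutionFor
            (fun a b c => ((1 - θ : ℝ) : ℂ) * AveragingDatum.form 𝒜 a b c +
              ((θ : ℝ) : ℂ) * Literature.Analysis.FluidPDE.Tao2016.eulerForm a b c)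
            (Literature.Analysis.FluidPDE.Tao2016.schwartzL2 u₀) (Set.Ico 0 S') v ∧
          ∀ t ∈ Set.Ico 0 S, v t = u t}

/-- **Navier–Stokes has a Schwartz-data `H¹⁰_df`-mild Type-I blow-up at ceiling `M`** (membership of the
crux's set at the Euler end `θ = 1`). -/
local notation3 "nsTypeI[" M "]" =>
  ∃ u₀ : SchwartzMap (EuclideanSpace ℝ (Fin 3)) (EuclideanSpace ℝ (Fin 3)),
    Literature.Analysis.FluidPDE.VectorCalculus.IsDivFree ⇑u₀ ∧ ∃ S : ℝ, 0 < S ∧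
    ∃ u : ℝ → Literature.Analysis.FluidPDE.Tao2016.L2C,
      Literature.Analysis.FluidPDE.Tao2016.IsMildSolutionFor
        Literature.Analysis.FluidPDE.Tao2016.eulerForm
        (Literature.Analysis.FluidPDE.Tao2016.schwartzL2 u₀) (Set.Ico 0 S) u ∧
      (∀ t ∈ Set.Ico 0 S, MeasureTheory.eLpNorm (u t) ⊤ MeasureTheory.volume ≤
        ENNReal.ofReal (M / Real.sqrt (S - t))) ∧
      ¬ ∃ S' : ℝ, S < S' ∧ ∃ v : ℝ → Literature.Analysis.FluidPDE.Tao2016.L2C,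
        Literature.Analysis.FluidPDE.Tao2016.IsMildSolutionFor
          Literature.Analysis.FluidPDE.Tao2016.eulerForm
          (Literature.Analysis.FluidPDE.Tao2016.schwartzL2 u₀) (Set.Ico 0 S') v ∧
        ∀ t ∈ Set.Ico 0 S, v t = u t

/-! ### Leaf A: the Navier–Stokes Type-I ceiling set is closed from below -/

/-- **Leaf A — `NSTypeICeilingClosed`.** A positive ceiling `K` all of whose strict upper ceilings `K' > K`
carry Schwartz-data `H¹⁰_df`-mild Type-I blow-ups of the true Navier–Stokes form carries one itself: the
infimal Type-I temperature of Navier–Stokes, if the ceiling set is non-empty, is ATTAINED by a Schwartz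
datum (or the set is empty). This is the NS-only content of the crux as filed (STRATEGY-CENSUS §0 W1) and is
literally the negation of the registered open statement `TypeIInfimumNotAttainedNS`
(`nsTypeICeilingClosed_iff_not_typeIInfimumNotAttainedNS`). OPEN both ways (a proof is Type-I exclusion for Schwartz-data
mild Navier–Stokes or Schwartz attainment of the infimal temperature; a disproof contains a Schwartz-data blow-up);
users take `(h : NSTypeICeilingClosed)` as an explicit hypothesis. [status: open] [topic Analysis/FluidPDE]
[cite: RusinSverak2011, §1 question (Q)] -/
@[conjecture] def NSTypeICeilingClosed : Prop :=
  ∀ K : ℝ, 0 < K → (∀ K' : ℝ, K < K' → nsTypeI[K']) → nsTypeI[K]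

/-- Leaf A is exactly `¬ TypeIInfimumNotAttainedNS` (classical logic on the two quantifier shapes). [folklore] -/
theorem nsTypeICeilingClosed_iff_not_typeIInfimumNotAttainedNS :
    NSTypeICeilingClosed ↔ ¬ TypeIInfimumNotAttainedNS := by
  unfold NSTypeICeilingClosed TypeIInfimumNotAttainedNS
  constructor
  · rintro h ⟨K, hK, hnot, hall⟩
    exact hnot (h K hK hall)
  · intro h K hK hall
    by_contra hnot
    exact h ⟨K, hK, hnot, hall⟩

/-- The crux as filed proves Leaf A (the zero-datum bite `nsTypeI_of_forall_lt_of_boundedTemperatureClosed`,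
restated). [cite: Tao2016AveragedNS, §1.1 (1.15)] -/
theorem nsTypeICeilingClosed_of_boundedTemperatureClosed (hC : BoundedTemperatureClosed) :
    NSTypeICeilingClosed :=
  fun _ hK hall => nsTypeI_of_forall_lt_of_boundedTemperatureClosed hC hK hall

/-- **Under Leaf A the ceiling set `𝒯 = {K | nsTypeI[K]}` is closed in `ℝ`.** It is an up-set
(`nsTypeI_mono`) contained in `[c₀, ∞)` for Leray's floor `c₀ > 0` (`exists_typeIFloor`); a point `K` of its
closure therefore has `K ≥ c₀ > 0`, every `K' > K` exceeds some member and is a member, and Leaf A puts `K`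
itself in `𝒯`. [cite: KochNadirashviliSereginSverak2009, §1] -/
theorem isClosed_ceilingSet (hA : NSTypeICeilingClosed) : IsClosed {K : ℝ | nsTypeI[K]} := by
  obtain ⟨c₀, hc₀, hfloor⟩ := exists_typeIFloor
  refine isClosed_of_closure_subset fun K hK => ?_
  rw [Metric.mem_closure_iff] at hK
  have hKpos : 0 < K := by
    by_contra hle
    push Not at hle
    obtain ⟨b, hb, hdist⟩ := hK c₀ hc₀
    have hb' : c₀ ≤ b := hfloor b hb
    rw [Real.dist_eq, abs_sub_comm, abs_of_nonneg (by linarith)] at hdist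
    linarith
  refine hA K hKpos fun K' hKK' => ?_
  obtain ⟨b, hb, hdist⟩ := hK (K' - K) (sub_pos.2 hKK')
  rw [Real.dist_eq] at hdist
  have hbK' : b ≤ K' := by
    have := (abs_sub_lt_iff.1 hdist).2
    linarith
  exact nsTypeI_mono hbK' hb

/-! ### Amplitude scaling by a nonzero real factor of either sign -/

/-- **Scaling of a Schwartz-data mild Type-I blow-up by `c ≠ 0` (either sign).** For
`T'(c a, c b, w) = c · T(a, b, w)`: a `T`-witness at ceiling `M` (Schwartz divergence-free datum, rate
`‖u t‖_∞ ≤ M/√(S-t)`, no mild extension) yields a `T'`-witness at ceiling `|c|·M` (datum `c • u₀`, curve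
`c • u`; an extension of `c • u` for `T'` rescales back by `c⁻¹`). The positive case is the landed
`typeIBlowup_smul`; the sign only enters through `‖c‖ = |c|` in the rate. [cite: Tao2016AveragedNS, §1.1 (1.15)] -/
theorem typeIBlowup_smul_abs (T T' : L2C → L2C → L2C → ℂ) (c : ℝ) (hc : c ≠ 0)
    (hT : ∀ a b w : L2C, T' (((c : ℝ) : ℂ) • a) (((c : ℝ) : ℂ) • b) w = ((c : ℝ) : ℂ) * T a b w)
    (M : ℝ)
    (h : ∃ u₀ : SchwartzMap (EuclideanSpace ℝ (Fin 3)) (EuclideanSpace ℝ (Fin 3)),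
      VectorCalculus.IsDivFree ⇑u₀ ∧ ∃ S : ℝ, 0 < S ∧ ∃ u : ℝ → L2C,
        IsMildSolutionFor T (schwartzL2 u₀) (Ico 0 S) u ∧
        (∀ t ∈ Ico 0 S, eLpNorm (u t) ⊤ volume ≤ ENNReal.ofReal (M / Real.sqrt (S - t))) ∧
        ¬ ∃ S' : ℝ, S < S' ∧ ∃ v : ℝ → L2C,
            IsMildSolutionFor T (schwartzL2 u₀) (Ico 0 S') v ∧ ∀ t ∈ Ico 0 S, v t = u t) :
    ∃ u₀ : SchwartzMap (EuclideanSpace ℝ (Fin 3)) (EuclideanSpace ℝ (Fin 3)),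
      VectorCalculus.IsDivFree ⇑u₀ ∧ ∃ S : ℝ, 0 < S ∧ ∃ u : ℝ → L2C,
        IsMildSolutionFor T' (schwartzL2 u₀) (Ico 0 S) u ∧
        (∀ t ∈ Ico 0 S, eLpNorm (u t) ⊤ volume ≤ ENNReal.ofReal (|c| * M / Real.sqrt (S - t))) ∧
        ¬ ∃ S' : ℝ, S < S' ∧ ∃ v : ℝ → L2C,
            IsMildSolutionFor T' (schwartzL2 u₀) (Ico 0 S') v ∧ ∀ t ∈ Ico 0 S, v t = u t := by
  obtain ⟨u₀, hdiv, S, hS, u, hu, hrate, hnoext⟩ := h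
  refine ⟨c • u₀, ?_, S, hS, fun t => ((c : ℝ) : ℂ) • u t, ?_, ?_, ?_⟩
  · -- the scaled datum is divergence free
    exact isDivFree_const_smul (u₀.smooth 1) hdiv c
  · -- `c • u` is `T'`-mild from `schwartzL2 (c • u₀) = c • schwartzL2 u₀`
    rw [schwartzL2_smul]
    exact isMildSolutionFor_smul T T' c hT _ _ _ hu
  · -- the Type-I rate at ceiling `|c| M`
    intro t ht
    have hcn : ‖((c : ℝ) : ℂ)‖ₑ = ENNReal.ofReal |c| := by
      rw [← ofReal_norm, Complex.norm_real, Real.norm_eq_abs]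
    show eLpNorm (((((c : ℝ) : ℂ) • u t : L2C)) : EuclideanSpace ℝ (Fin 3) → EuclideanSpace ℂ (Fin 3))
        ⊤ volume ≤ ENNReal.ofReal (|c| * M / Real.sqrt (S - t))
    rw [eLpNorm_coe_const_smul, hcn]
    calc ENNReal.ofReal |c| * eLpNorm (u t : EuclideanSpace ℝ (Fin 3) → EuclideanSpace ℂ (Fin 3)) ⊤ volume
        ≤ ENNReal.ofReal |c| * ENNReal.ofReal (M / Real.sqrt (S - t)) :=
          mul_le_mul_right (hrate t ht) _
      _ = ENNReal.ofReal (|c| * M / Real.sqrt (S - t)) := by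
          rw [← ENNReal.ofReal_mul (abs_nonneg c), mul_div_assoc]
  · -- no `T'`-mild extension of `c • u`: rescale one back by `c⁻¹`
    rintro ⟨S', hSS', v, hv, hvu⟩
    refine hnoext ⟨S', hSS', fun t => ((c⁻¹ : ℝ) : ℂ) • v t, ?_, fun t ht => ?_⟩
    · have h2 := isMildSolutionFor_smul T' T c⁻¹ (smul_inv_of_smul T T' hc hT) _ _ _ hv
      rwa [schwartzL2_smul, inv_smul_smul_ofReal hc] at h2
    · show ((c⁻¹ : ℝ) : ℂ) • v t = u t
      have h3 : v t = ((c : ℝ) : ℂ) • u t := hvu t ht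
      rw [h3, inv_smul_smul_ofReal hc]

/-! ### The collinear sector, every sign of the coefficient -/

/-- **Membership along a collinear segment, coefficient of either sign.** If `B̃_𝒜 = κ·B` on `H¹⁰_df`,
then for `θ ∈ [0,1]` with `c := (1-θ)κ + θ ≠ 0`: `θ ∈ S_{𝒜,M} ↔ nsTypeI[|c|·M]` — on `H¹⁰_df` the segment
form is `c·B` (`isMildSolutionFor_Ico_congr_memH10df`), and `u ↦ c u`, `u ↦ c⁻¹ u` exchange `c·B`-witnesses
at ceiling `M` with `B`-witnesses at ceiling `|c|M` (`typeIBlowup_smul_abs`). The case `c > 0` is the landed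
`mem_btSet_iff_of_form_eq_smul`. [cite: Tao2016AveragedNS, §1.1 (1.15)] -/
theorem mem_btSet_iff_of_form_eq_smul_of_ne_zero {𝒜 : AveragingDatum} {κ : ℝ}
    (hκ : ∀ u v w : L2C, MemH10df u → MemH10df v → MemH10df w →
      𝒜.form u v w = ((κ : ℝ) : ℂ) * eulerForm u v w)
    {θ : ℝ} (hθ0 : 0 ≤ θ) (hθ1 : θ ≤ 1) (hc : (1 - θ) * κ + θ ≠ 0) (M : ℝ) :
    θ ∈ btSet[𝒜, M] ↔ nsTypeI[|(1 - θ) * κ + θ| * M] := by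
  set c : ℝ := (1 - θ) * κ + θ with hcdef
  have hdiag : ∀ a w : L2C, MemH10df a → MemH10df w →
      ((1 - θ : ℝ) : ℂ) * 𝒜.form a a w + ((θ : ℝ) : ℂ) * eulerForm a a w =
        ((c : ℝ) : ℂ) * eulerForm a a w := fun a w ha hw => by
    rw [hκ a a w ha ha hw, hcdef]
    push_cast
    ring
  have hT1 : ∀ a b w : L2C, eulerForm (((c : ℝ) : ℂ) • a) (((c : ℝ) : ℂ) • b) w =
      ((c : ℝ) : ℂ) * (((c : ℝ) : ℂ) * eulerForm a b w) := fun a b w => by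
    rw [eulerForm_smul_smul]
    ring
  have hT2 : ∀ a b w : L2C, ((c : ℝ) : ℂ) * eulerForm (((c⁻¹ : ℝ) : ℂ) • a) (((c⁻¹ : ℝ) : ℂ) • b) w =
      ((c⁻¹ : ℝ) : ℂ) * eulerForm a b w := fun a b w => by
    have hcC : ((c : ℝ) : ℂ) ≠ 0 := Complex.ofReal_ne_zero.2 hc
    rw [eulerForm_smul_smul, Complex.ofReal_inv]
    field_simp
  simp only [mem_setOf_eq,
    isMildSolutionFor_Ico_congr_memH10df
      (T := fun a b w => ((1 - θ : ℝ) : ℂ) * 𝒜.form a b w + ((θ : ℝ) : ℂ) * eulerForm a b w)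
      (T' := fun a b w => ((c : ℝ) : ℂ) * eulerForm a b w) hdiag]
  constructor
  · rintro ⟨-, hw⟩
    exact typeIBlowup_smul_abs (fun a b w => ((c : ℝ) : ℂ) * eulerForm a b w) eulerForm c hc hT1 M hw
  · intro hw
    have h := typeIBlowup_smul_abs eulerForm (fun a b w => ((c : ℝ) : ℂ) * eulerForm a b w) c⁻¹
      (inv_ne_zero hc) hT2 (|c| * M) hw
    rw [abs_inv, ← mul_assoc, inv_mul_cancel₀ (abs_ne_zero.2 hc), one_mul] at h
    exact ⟨⟨hθ0, hθ1⟩, h⟩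

/-- **The heat point of a collinear segment is never a member.** If `B̃_𝒜 = κ·B` on `H¹⁰_df` and
`(1-θ)κ + θ = 0`, the segment form at `θ` vanishes on the `H¹⁰_df`-diagonal, so a witness at `θ` would be a
witness of the zero averaging datum's segment at its own heat point `θ = 0`, excluded by the landed
`zero_not_mem_btSet_of_form_eq_zero` (the heat flow does not blow up and extends). [cite: Tao2016AveragedNS, §1.1 (1.15)] -/
theorem not_mem_btSet_of_form_eq_smul_of_eq_zero {𝒜 : AveragingDatum} {κ : ℝ}
    (hκ : ∀ u v w : L2C, MemH10df u → MemH10df v → MemH10df w →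
      𝒜.form u v w = ((κ : ℝ) : ℂ) * eulerForm u v w)
    {θ : ℝ} (hc : (1 - θ) * κ + θ = 0) (M : ℝ) : θ ∉ btSet[𝒜, M] := by
  obtain ⟨𝒜₀, -, -, h0⟩ := exists_form_eq_zero
  have hdiag : ∀ a w : L2C, MemH10df a → MemH10df w →
      ((1 - θ : ℝ) : ℂ) * 𝒜.form a a w + ((θ : ℝ) : ℂ) * eulerForm a a w =
        ((1 - (0 : ℝ) : ℝ) : ℂ) * 𝒜₀.form a a w + (((0 : ℝ) : ℝ) : ℂ) * eulerForm a a w := by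
    intro a w ha hw
    rw [hκ a a w ha ha hw, h0]
    have hcast : ((1 - θ : ℝ) : ℂ) * (((κ : ℝ) : ℂ) * eulerForm a a w) + ((θ : ℝ) : ℂ) * eulerForm a a w =
        (((1 - θ) * κ + θ : ℝ) : ℂ) * eulerForm a a w := by
      push_cast
      ring
    rw [hcast, hc]
    push_cast
    ring
  rintro ⟨-, u₀, hdiv, S, hS, u, hu, hrate, hnoext⟩
  refine zero_not_mem_btSet_of_form_eq_zero h0 M ⟨⟨le_rfl, zero_le_one⟩, u₀, hdiv, S, hS, u,
    (isMildSolutionFor_Ico_congr_memH10df hdiag).1 hu, hrate, ?_⟩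
  rintro ⟨S', hSS', v, hv, hvu⟩
  exact hnoext ⟨S', hSS', v, (isMildSolutionFor_Ico_congr_memH10df hdiag).2 hv, hvu⟩

/-- **The collinear sector is closed under Leaf A.** If `B̃_𝒜 = κ·B` on `H¹⁰_df` (any real `κ`), then
`S_{𝒜,M} = [0,1] ∩ (θ ↦ |(1-θ)κ+θ|·M)⁻¹(𝒯)` with `𝒯 = {K | nsTypeI[K]}` (the heat point drops out because
`0 ∉ 𝒯`, `pos_of_nsTypeI`), and `𝒯` is closed under Leaf A (`isClosed_ceilingSet`), so `S_{𝒜,M}` is the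
intersection of `[0,1]` with a continuous preimage of a closed set. [cite: Tao2016AveragedNS, §1.1 (1.15)] -/
theorem isClosed_btSet_of_form_eq_smul (hA : NSTypeICeilingClosed) {𝒜 : AveragingDatum} {κ : ℝ}
    (hκ : ∀ u v w : L2C, MemH10df u → MemH10df v → MemH10df w →
      𝒜.form u v w = ((κ : ℝ) : ℂ) * eulerForm u v w)
    (M : ℝ) : IsClosed btSet[𝒜, M] := by
  have hT := isClosed_ceilingSet hA
  have heq : btSet[𝒜, M] =
      Icc (0 : ℝ) 1 ∩ (fun θ : ℝ => |(1 - θ) * κ + θ| * M) ⁻¹' {K : ℝ | nsTypeI[K]} := by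
    ext θ
    constructor
    · intro h
      have hθ : θ ∈ Icc (0 : ℝ) 1 := h.1
      refine ⟨hθ, ?_⟩
      by_cases hc : (1 - θ) * κ + θ = 0
      · exact absurd h (not_mem_btSet_of_form_eq_smul_of_eq_zero hκ hc M)
      · exact (mem_btSet_iff_of_form_eq_smul_of_ne_zero hκ hθ.1 hθ.2 hc M).1 h
    · rintro ⟨hθ, hw⟩
      have hw' : nsTypeI[|(1 - θ) * κ + θ| * M] := hw
      by_cases hc : (1 - θ) * κ + θ = 0
      · exfalso
        rw [hc, abs_zero, zero_mul] at hw'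
        exact lt_irrefl _ (pos_of_nsTypeI hw')
      · exact (mem_btSet_iff_of_form_eq_smul_of_ne_zero hκ hθ.1 hθ.2 hc M).2 hw'
  rw [heq]
  exact isClosed_Icc.inter (hT.preimage (by fun_prop))

/-! ### Leaf B and the exact split -/

/-- **Leaf B — `OffCollinearClosed`.** The crux restricted to averaging data whose form is NOT a real
multiple of the Euler form on `H¹⁰_df`: for such (symmetric, cancelling) `𝒜` and every ceiling `M`, the
bounded-temperature blow-up set `S_{𝒜,M}` along the segment `T_θ = (1-θ)B̃_𝒜 + θB` is closed. Off the
collinear sector every `θ < 1` carries a genuine averaged component, so no zero-datum / κ-Euler bite applies;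
the statement is Door-grade two-parameter compactness (STRATEGY-CENSUS §5 D2) — OPEN, no approach and no counterexample on
file; users take `(h : OffCollinearClosed)` as an explicit hypothesis. [status: open] [topic Analysis/FluidPDE]
[cite: Tao2016AveragedNS, §1.1 (1.15)] -/
@[conjecture] def OffCollinearClosed : Prop :=
  ∀ 𝒜 : AveragingDatum, 𝒜.IsSymmetric → 𝒜.HasCancellation →
    (¬ ∃ κ : ℝ, ∀ u v w : L2C, MemH10df u → MemH10df v → MemH10df w →
        𝒜.form u v w = ((κ : ℝ) : ℂ) * eulerForm u v w) →
    ∀ M : ℝ, IsClosed btSet[𝒜, M]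

/-- Leaf B is a restriction of the crux. [folklore] -/
theorem offCollinearClosed_of_boundedTemperatureClosed (hC : BoundedTemperatureClosed) :
    OffCollinearClosed :=
  fun 𝒜 hs hc _ M => hC 𝒜 hs hc M

/-- **The glue `Leaf A → Leaf B → crux`** (case split on collinearity; the collinear case is
`isClosed_btSet_of_form_eq_smul`). [cite: Tao2016AveragedNS, §1.1 (1.15)] -/
theorem boundedTemperatureClosed_of_subs (hA : NSTypeICeilingClosed) (hB : OffCollinearClosed) :
    BoundedTemperatureClosed := by
  intro 𝒜 hs hc M
  by_cases hcol : ∃ κ : ℝ, ∀ u v w : L2C, MemH10df u → MemH10df v → MemH10df w →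
      𝒜.form u v w = ((κ : ℝ) : ℂ) * eulerForm u v w
  · obtain ⟨κ, hκ⟩ := hcol
    exact isClosed_btSet_of_form_eq_smul hA hκ M
  · exact hB 𝒜 hs hc hcol M

/-- **The split is exact**: the crux as filed is EQUIVALENT to `Leaf A ∧ Leaf B` — its Navier–Stokes-only
content (`Leaf A = ¬ TypeIInfimumNotAttainedNS`) and its off-collinear geometric content separate cleanly.
[cite: Tao2016AveragedNS, §1.1 (1.15)] -/
theorem boundedTemperatureClosed_iff_subs :
    BoundedTemperatureClosed ↔ NSTypeICeilingClosed ∧ OffCollinearClosed :=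
  ⟨fun h => ⟨nsTypeICeilingClosed_of_boundedTemperatureClosed h,
      offCollinearClosed_of_boundedTemperatureClosed h⟩,
    fun h => boundedTemperatureClosed_of_subs h.1 h.2⟩

/-- Hence, off the NS dichotomy, the crux is exactly its off-collinear part:
`¬ TypeIInfimumNotAttainedNS → (crux ↔ Leaf B)`. [folklore] -/
theorem boundedTemperatureClosed_iff_offCollinear_of_not_H (hH : ¬ TypeIInfimumNotAttainedNS) :
    BoundedTemperatureClosed ↔ OffCollinearClosed :=
  ⟨offCollinearClosed_of_boundedTemperatureClosed,
    boundedTemperatureClosed_of_subs (nsTypeICeilingClosed_iff_not_typeIInfimumNotAttainedNS.2 hH)⟩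

/-! ### The joint-closedness strengthening (S1) -/

/-- **Strengthening S1 — `JointClosed`.** Closedness of the bounded-temperature blow-up RELATION in the
two parameters `(θ, M)`: for every symmetric cancelling datum the set `{(θ, M) | θ ∈ S_{𝒜,M}}` is closed in
`ℝ × ℝ` (lower semicontinuity of the temperature map plus attainment). OPEN (it implies the crux, hence Leaf A); users
take `(h : JointClosed)` as an explicit hypothesis. [status: open] [topic Analysis/FluidPDE] [cite: Tao2016AveragedNS, §1.1 (1.15)] -/
@[conjecture] def JointClosed : Prop :=
  ∀ 𝒜 : AveragingDatum, 𝒜.IsSymmetric → 𝒜.HasCancellation →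
    IsClosed {p : ℝ × ℝ | p.1 ∈ btSet[𝒜, p.2]}

/-- S1 implies the crux (slices of a closed set are closed), hence inherits Leaf A: the extra variable buys
nothing at the zero datum, where the amplitude symmetry already trades `θ` for `M`. [folklore] -/
theorem boundedTemperatureClosed_of_jointClosed (hJ : JointClosed) : BoundedTemperatureClosed := by
  intro 𝒜 hs hc M
  have h := (hJ 𝒜 hs hc).preimage (f := fun θ : ℝ => (θ, M)) (by fun_prop)
  have heq : btSet[𝒜, M] = (fun θ : ℝ => (θ, M)) ⁻¹' {p : ℝ × ℝ | p.1 ∈ btSet[𝒜, p.2]} := by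
    ext θ
    exact Iff.rfl
  rw [heq]
  exact h

/-- S1 therefore also proves the NS leaf. [folklore] -/
theorem nsTypeICeilingClosed_of_jointClosed (hJ : JointClosed) : NSTypeICeilingClosed :=
  nsTypeICeilingClosed_of_boundedTemperatureClosed (boundedTemperatureClosed_of_jointClosed hJ)

end Summit.NavierStokesRegularity.NavierStokesRegularity.Theorems.PumpContinuationBoundedTemperatureClosedSplit

end
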